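import Mathlib.NumberTheory.ArithmeticFunction.Liouville
import Mathlib.NumberTheory.LegendreSymbol.JacobiSymbol
import Mathlib.NumberTheory.LSeries.RiemannZeta
import Mathlib.Analysis.SpecialFunctions.Trigonometric.Basic
import Mathlib.Analysis.PSeries
import Mathlib.Algebra.Squarefree.Basic
import HarnessLib

/-!
# Conrey's sine-series criteria for the Riemann Hypothesis via character sums
# (Conrey 2024, Thms. 1, 3, 4, Cor. 1, Prop. 1)

Topic `Literature/NumberTheory/LFunctions`; sibling of `LiouvilleOneSidedRH.lean` (Pólya 1919 /
Ingham 1942: a one-sided bound on `L(x) = ∑_{n ≤ x} λ(n)` gives RH — the "order `0`" sibling of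
Theorem 1 below, PROVED there as `riemannHypothesis_of_liouvilleSum_oneSided`). Requested (ledger
`wi-36939`) by route `RiemannHypothesis/CharacterSums`, whose items `LiouvilleSineCriterion`,
`CharacterImitation`, `FiniteForm` (stmt-RiemannHypothesis-16981/16982/16983) restate Theorems 1, 3
and Corollary 1 on the summit side, to be PROVED there; this file vendors the printed statements
as NAMED FACTS (D-0014) with the paper's objects `f`, `f_q`, `S_q` as definitions, for grounding
and citation.

## Source (quoted from the held text `paper:arxiv-2404.19647`)

J. B. Conrey, *Character sums and the Riemann Hypothesis*, Acta Arith. (2024),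
doi:10.4064/aa230530-13-11 = arXiv:2404.19647 [Conrey2024CharacterSums]:

* (p. 2) "Let `f(x) = ∑_{n=1}^∞ λ(n) sin(2πnx)/n²` where `λ` is the Liouville lambda-function.
  Since `|λ(n)| = 1`, this series is absolutely convergent for real `x`, so that `f` is continuous,
  odd and periodic with period 1 on `ℝ`."  **Theorem 1.** "If `f(x) ≥ 0` for `0 ≤ x ≤ 1/4`, then
  the Riemann Hypothesis is true."  "The '1/4' in Theorem 1 can be replaced by any positive
  constant."  (Proof, §4 p. 6: Mellin identity
  `πX(1-s)ζ(2s+2)/((1-s)ζ(s+1)) = ∫₀^∞ f(x) x^{s-2} dx`, the tail `∫₄^∞` is entire by periodicity,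
  Landau's lemma [MV1, Lemma 15.1], rightmost real pole at `s = -1/2`.)
* (§2, p. 4) "`f_q(x) = ∑_{n=1}^∞ (n/q) sin(2πnx)/n²` […] with `λ(n)` replaced by `(n/q)`"
  (`(·/q)` the Legendre symbol).  **Theorem 3.** "If `f_q(x) ≥ 0` for all `0 ≤ x ≤ 1/4` and all
  primes `q` congruent to 3 mod 8, then the Riemann Hypothesis is true."  (Proof sketched before
  the statement: for every `N` a prime `q ≡ 3 (mod 8)` has `(n/q) = λ(n)` for all `n ≤ N` — CRT,
  reciprocity, Dirichlet — and `|f(x) - ∑_{n ≤ N}| < 1/N`.)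
* **Theorem 4.** "Let `x ≥ 0`. Let `q ≡ 3 mod 8` be squarefree. Then
  `f_q(x) = 2πx L_q(1) - (2π²x/√q) ∑_{n ≤ xq} (n/q)(1 - n/(xq))` where
  `L_q(1) = ∑_{n=1}^∞ (n/q)/n`."  Then (p. 4): "`h(q) = (√q/π) L_q(1)` for squarefree
  `q ≡ 3 mod 4` and `q > 3`", "`L_q(1) = -(π/q^{3/2}) ∑_{n=1}^q n (n/q)`", and "`h(q) = S_q(q/2)`
  where `S_q(N) := ∑_{n ≤ N} (n/q)(1 - n/N)`".  **Corollary 1.** "Let `q > 3` be squarefree with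
  `q ≡ 3 mod 8`. Then `f_q(x) = (2π²x/√q)(S_q(q/2) - S_q(qx))`."  (Proof of Thm. 4, §4 p. 6:
  Lemma 1, the functional equation of `L(s, χ_q)`, Lemma 3.)
* (p. 10) **Proposition 1.** "If `f_q(x) = 0` then `x` is a rational number."  Printed proof: "By
  Corollary 1, `f_q(x) = 0` implies that `S_q(q/2) - S_q(qx) = 0`. But `S_q(q/2) = h(q)` is an
  integer. […] `S_q(qx) = ∑_{n ≤ [qx]} χ_q(n) - (∑_{n ≤ [qx]} n χ_q(n))/(qx)`. This has the shape
  integer `-` integer/(qx) which can only be rational if `x` is a rational number."  And (same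
  page): "Suppose that `f_q(x) = 0`. Let `y = xq`. Then either `∑_{n ≤ y} χ_q(n) = h(q)` and
  `∑_{n ≤ y} n χ_q(n) = 0` or else `y = (∑_{n ≤ [y]} n χ_q(n)) / (∑_{n ≤ [y]} χ_q(n) - h(q))`. The
  first alternative seems unlikely as in that case there would be an interval on which `f_q(x)`
  would be identically 0."

## Rendering and faithfulness

* `Conrey2024.f`, `Conrey2024.fq q`, `Conrey2024.S q N` are the printed `f`, `f_q`, `S_q(N)`:
  `∑'` over `n : ℕ` (the `n = 0` term is `0`; the series are absolutely convergent, so Lean's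
  unconditional `tsum` is the printed sum), `(n/q)` = Mathlib's `jacobiSym n q` (the Legendre
  symbol for `q` prime, as in Thm. 3; the Jacobi symbol for `q` squarefree, the primitive real
  character mod `q` of Thm. 4 / Cor. 1 — cf. the tree's `apply_natCast_eq_jacobiSym`,
  `PrimitiveQuadraticCharacter.lean`), `S_q(N) = ∑_{1 ≤ n ≤ ⌊N⌋} (n/q)(1 - n/N)` for real `N`.
  These are, token for token, the expressions written out in the route items
  `Summit.RiemannHypothesis.RiemannHypothesis.Theses.CharacterSums.{ConreyPositivity,
  LiouvilleSineCriterion, CharacterImitation, FiniteForm}` (which unfold to them by `rfl`).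
* Theorem 1 is vendored AS PRINTED with the constant `1/4` (`Conrey2024_theorem1`); the remark
  "can be replaced by any positive constant" is recorded here but not vendored as a second fact
  (it implies the printed one; the route's `LiouvilleSineCriterion` is that stronger form and is to
  be proved on the summit side). "the Riemann Hypothesis" = Mathlib's `RiemannHypothesis`.
* Theorem 4 is vendored in the form of **Corollary 1** (`Conrey2024_corollary1`, hypotheses
  `q > 3` squarefree, `q ≡ 3 (mod 8)`, and `x ≥ 0` inherited from Thm. 4 — for `x < 0` both `f_q`
  (odd) and the right side change, and the identity fails): its right side is a FINITE sum,
  whereas the `L_q(1) = ∑ (n/q)/n` of Thm. 4 is only conditionally convergent and has no faithful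
  `tsum` rendering. (The passage Thm. 4 ⇒ Cor. 1 is `2πx L_q(1) = (2π²x/√q) S_q(q/2)`, i.e.
  `L_q(1) = (π/√q) S_q(q/2)`, equivalent to Dirichlet's `L_q(1) = -(π/q^{3/2}) ∑_{n=1}^{q} n (n/q)`
  by `∑_{n=1}^{q-1} n χ(n) = 2∑_{n<q/2} n χ(n) - q ∑_{n<q/2} χ(n)` for odd `χ`; the intermediate
  display "`L_q(1) = -(2π/q^{3/2}) ∑_{n ≤ (q-1)/2} n (n/q)`" printed on p. 4 drops the term
  `(π/√q)∑_{n<q/2}(n/q)` and is not used.)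
* Proposition 1 is NOT vendored as "every zero is rational": the printed argument ("integer `-`
  integer/(qx) can only be rational if `x` is rational") presumes the second integer
  `∑_{n ≤ [qx]} n χ_q(n)` is non-zero, and the source itself records the complete dichotomy quoted
  above. What Corollary 1 does prove is that dichotomy, and it is PROVED here from the named fact
  (`Conrey2024.fq_eq_zero_dichotomy`, with `S_q(q/2)` in place of `h(q)`; the class-number
  identity `h(q) = S_q(q/2)` is not needed for it and is not restated).
* Theorem 2 (the explicit formula under RH), Cor. 2, Thm. 5 and Conjectures 1–3 are not
  vendored (conjectures are not Literature; Conjecture 1 ∩ Thm. 3 is the route's crux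
  `ConreyPositivity`).

## References

* [Conrey2024CharacterSums] J. B. Conrey, Acta Arith. (2024), doi:10.4064/aa230530-13-11,
  arXiv:2404.19647: Thm. 1 (p. 2; proof §4, p. 6), Thm. 3, Thm. 4, Cor. 1 (§2, p. 4; proof §4,
  p. 6), Prop. 1 (p. 10) — held text `paper:arxiv-2404.19647`.
* H. L. Montgomery, R. C. Vaughan, *Multiplicative Number Theory I*, CUP 2007, Lemma 15.1
  (Landau's lemma, the engine of Thm. 1). [MontgomeryVaughan2007]
-/

noncomputable section

open scoped BigOperators
open Real

namespace Literature.NumberTheory.LFunctions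

/-! ### The objects: `f`, `f_q`, `S_q` -/

namespace Conrey2024

/-- Conrey's twice-smoothed Liouville sine series `f(x) = ∑_{n ≥ 1} λ(n) sin(2πnx)/n²`
(absolutely convergent; continuous, odd, `1`-periodic). The `n = 0` term of the `tsum` vanishes.
[cite: Conrey2024CharacterSums, p. 2 (definition of f)] -/
def f (x : ℝ) : ℝ :=
  ∑' n : ℕ, (ArithmeticFunction.liouville n : ℝ) * Real.sin (2 * π * n * x) / (n : ℝ) ^ 2

/-- Conrey's character sine series `f_q(x) = ∑_{n ≥ 1} (n/q) sin(2πnx)/n²`, "`λ(n)` replaced by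
the Legendre symbol `(n/q)`" (Mathlib `jacobiSym`, which is the Legendre symbol for `q` prime and
the Jacobi symbol for `q` squarefree). [cite: Conrey2024CharacterSums, §2 p. 4 (definition of f_q)] -/
def fq (q : ℕ) (x : ℝ) : ℝ :=
  ∑' n : ℕ, (jacobiSym (n : ℤ) q : ℝ) * Real.sin (2 * π * n * x) / (n : ℝ) ^ 2

/-- Conrey's Cesàro character sum `S_q(N) = ∑_{n ≤ N} (n/q)(1 - n/N)` (`N` real, sum over
`1 ≤ n ≤ ⌊N⌋`; empty for `N < 1`). [cite: Conrey2024CharacterSums, §2 p. 4 (definition of S_q)] -/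
def S (q : ℕ) (N : ℝ) : ℝ :=
  ∑ n ∈ Finset.Icc 1 ⌊N⌋₊, (jacobiSym (n : ℤ) q : ℝ) * (1 - (n : ℝ) / N)

/-- The terms of `f` are dominated by `1/n²`, so the series converges absolutely ("Since
`|λ(n)| = 1`, this series is absolutely convergent for real `x`", p. 2). [cite: Conrey2024CharacterSums, p. 2] -/
theorem summable_f_term (x : ℝ) :
    Summable fun n : ℕ =>
      (ArithmeticFunction.liouville n : ℝ) * Real.sin (2 * π * n * x) / (n : ℝ) ^ 2 := by
  refine Summable.of_norm_bounded (g := fun n : ℕ => 1 / (n : ℝ) ^ 2)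
    (Real.summable_one_div_nat_pow.mpr one_lt_two) fun n => ?_
  rw [Real.norm_eq_abs, abs_div, abs_mul, abs_pow, Nat.abs_cast]
  refine div_le_div_of_nonneg_right ?_ (by positivity)
  -- `|λ(n)| ≤ 1` (also the tree's `Literature.NumberTheory.Sieve.abs_liouville_le_one`, not
  -- imported here to keep this file free of the sieve hierarchy)
  have hl : |(ArithmeticFunction.liouville n : ℝ)| ≤ 1 := by
    rcases eq_or_ne n 0 with rfl | hn
    · simp
    · rw [ArithmeticFunction.liouville_apply hn]
      push_cast
      rw [abs_pow, abs_neg, abs_one, one_pow]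
  calc |(ArithmeticFunction.liouville n : ℝ)| * |Real.sin (2 * π * n * x)| ≤ 1 * 1 :=
        mul_le_mul hl (Real.abs_sin_le_one _) (abs_nonneg _) zero_le_one
    _ = 1 := one_mul 1

/-- `|(n/q)| ≤ 1` for the Jacobi symbol (values in `{0, 1, -1}`). [folklore] -/
theorem abs_jacobiSym_le_one (n : ℕ) (q : ℕ) : |(jacobiSym (n : ℤ) q : ℝ)| ≤ 1 := by
  rcases jacobiSym.trichotomy (n : ℤ) q with h | h | h <;> simp [h]

/-- Likewise for `f_q`: `|(n/q)| ≤ 1`. [cite: Conrey2024CharacterSums, §2 p. 4] -/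
theorem summable_fq_term (q : ℕ) (x : ℝ) :
    Summable fun n : ℕ => (jacobiSym (n : ℤ) q : ℝ) * Real.sin (2 * π * n * x) / (n : ℝ) ^ 2 := by
  refine Summable.of_norm_bounded (g := fun n : ℕ => 1 / (n : ℝ) ^ 2)
    (Real.summable_one_div_nat_pow.mpr one_lt_two) fun n => ?_
  rw [Real.norm_eq_abs, abs_div, abs_mul, abs_pow, Nat.abs_cast]
  refine div_le_div_of_nonneg_right ?_ (by positivity)
  calc |(jacobiSym (n : ℤ) q : ℝ)| * |Real.sin (2 * π * n * x)| ≤ 1 * 1 :=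
        mul_le_mul (abs_jacobiSym_le_one n q) (Real.abs_sin_le_one _) (abs_nonneg _) zero_le_one
    _ = 1 := one_mul 1

/-- `f` is odd: `f(-x) = -f(x)` ("`f` is continuous, odd and periodic with period 1", p. 2).
[cite: Conrey2024CharacterSums, p. 2] -/
theorem f_neg (x : ℝ) : f (-x) = -f x := by
  simp only [f, mul_neg, Real.sin_neg, ← tsum_neg]
  congr 1; funext n; ring

/-- `f_q` is odd. [cite: Conrey2024CharacterSums, §2 p. 4] -/
theorem fq_neg (q : ℕ) (x : ℝ) : fq q (-x) = -fq q x := by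
  simp only [fq, mul_neg, Real.sin_neg, ← tsum_neg]
  congr 1; funext n; ring

/-- `S_q(N) = 0` for `N < 1` (empty sum). [cite: Conrey2024CharacterSums, §2 p. 4] -/
theorem S_of_lt_one (q : ℕ) {N : ℝ} (hN : N < 1) : S q N = 0 := by
  have h : ⌊N⌋₊ = 0 := Nat.floor_eq_zero.mpr hN
  simp [S, h]

/-- `S_q(N)` split: `S_q(N) = ∑_{n ≤ N} (n/q) - (∑_{n ≤ N} n (n/q)) / N` (p. 10, proof of
Prop. 1). [cite: Conrey2024CharacterSums, p. 10 (proof of Prop. 1)] -/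
theorem S_eq_sum_sub_div (q : ℕ) (N : ℝ) :
    S q N = (∑ n ∈ Finset.Icc 1 ⌊N⌋₊, (jacobiSym (n : ℤ) q : ℝ)) -
      (∑ n ∈ Finset.Icc 1 ⌊N⌋₊, (n : ℝ) * (jacobiSym (n : ℤ) q : ℝ)) / N := by
  simp only [S, mul_sub, mul_one, Finset.sum_sub_distrib, Finset.sum_div]
  congr 1
  refine Finset.sum_congr rfl fun n _ => ?_
  ring

end Conrey2024

/-! ### The named facts -/

/-- **Conrey (2024), Theorem 1: one-signedness of the Liouville sine series near `0` implies the
Riemann Hypothesis.** "If `f(x) ≥ 0` for `0 ≤ x ≤ 1/4`, then the Riemann Hypothesis is true",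
`f(x) = ∑_{n ≥ 1} λ(n) sin(2πnx)/n²` (`Conrey2024.f`); RH = Mathlib's `RiemannHypothesis`. The
source adds that `1/4` "can be replaced by any positive constant" (the proof splits the Mellin
integral at `x = 4 = 1/(1/4)`); only the printed statement is vendored. Proof in print: §4, via
Landau's lemma (Montgomery–Vaughan, Lemma 15.1). A named fact (D-0014): users take
`(h : Conrey2024_theorem1)`; the summit-side item
`Summit.RiemannHypothesis.RiemannHypothesis.Theses.CharacterSums.LiouvilleSineCriterion` is its
any-positive-constant form. [cite: Conrey2024CharacterSums, Thm. 1 (p. 2; proof §4 p. 6)] -/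
def Conrey2024_theorem1 : Prop :=
  (∀ x : ℝ, 0 ≤ x → x ≤ 1 / 4 → 0 ≤ Conrey2024.f x) → RiemannHypothesis

/-- **Conrey (2024), Theorem 3: positivity of the Legendre-symbol sine series for all primes
`q ≡ 3 (mod 8)` implies the Riemann Hypothesis.** "If `f_q(x) ≥ 0` for all `0 ≤ x ≤ 1/4` and all
primes `q` congruent to 3 mod 8, then the Riemann Hypothesis is true" (`f_q = Conrey2024.fq q`,
the Legendre symbol being `jacobiSym · q` for `q` prime). Printed proof: the Legendre symbols of
such `q` imitate `λ` on arbitrarily long initial segments (CRT, quadratic reciprocity, Dirichlet's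
theorem) and the tails are `< 1/N`, reducing to Theorem 1. A named fact (D-0014): users take
`(h : Conrey2024_theorem3)`; its hypothesis is VERBATIM the route crux
`Summit.RiemannHypothesis.RiemannHypothesis.Theses.CharacterSums.ConreyPositivity`.
[cite: Conrey2024CharacterSums, Thm. 3 (§2 p. 4)] -/
def Conrey2024_theorem3 : Prop :=
  (∀ q : ℕ, q.Prime → q % 8 = 3 → ∀ x : ℝ, 0 ≤ x → x ≤ 1 / 4 → 0 ≤ Conrey2024.fq q x) →
    RiemannHypothesis

/-- **Conrey (2024), Corollary 1 (of Theorem 4): the finite form of `f_q`.** "Let `q > 3` be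
squarefree with `q ≡ 3 mod 8`. Then `f_q(x) = (2π²x/√q)(S_q(q/2) - S_q(qx))`", for `x ≥ 0` (the
standing hypothesis of Theorem 4, "Let `x ≥ 0`. Let `q ≡ 3 mod 8` be squarefree. Then
`f_q(x) = 2πx L_q(1) - (2π²x/√q) ∑_{n ≤ xq} (n/q)(1 - n/(xq))`", combined with Dirichlet's
class-number formula in the form `L_q(1) = (π/√q) S_q(q/2)`, i.e. `h(q) = S_q(q/2)`); here
`S_q(N) = ∑_{n ≤ N} (n/q)(1 - n/N)` (`Conrey2024.S`) and `(n/q)` is the Jacobi symbol. A named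
fact (D-0014): users take `(h : Conrey2024_corollary1)`; the summit-side item
`Summit.RiemannHypothesis.RiemannHypothesis.Theses.CharacterSums.FiniteForm` is this identity for
`q` prime (there also at `q = 3`, where the same formula holds although `S_3(3/2) = 1/3 ≠ h(3)`).
[cite: Conrey2024CharacterSums, Cor. 1 and Thm. 4 (§2 p. 4; proof §4 p. 6)] -/
def Conrey2024_corollary1 : Prop :=
  ∀ q : ℕ, Squarefree q → q % 8 = 3 → 3 < q → ∀ x : ℝ, 0 ≤ x →
    Conrey2024.fq q x =
      2 * π ^ 2 * x / Real.sqrt q * (Conrey2024.S q (q / 2) - Conrey2024.S q (q * x))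

/-! ### Proposition 1, in the form its printed proof establishes -/

/-- **Conrey (2024), Proposition 1 — the dichotomy the proof gives.** From Corollary 1: if
`f_q(x) = 0` with `x > 0` (`q > 3` squarefree, `q ≡ 3 (mod 8)`), then with `y = qx`,
`A = ∑_{n ≤ [y]} (n/q)` and `B = ∑_{n ≤ [y]} n (n/q)`, EITHER `A = S_q(q/2)` and `B = 0`, OR
`A ≠ S_q(q/2)` and `x = B / (q (A - S_q(q/2)))` (so `x` is rational, `S_q(q/2) = ∑ (n/q)(1 - 2n/q)`
being rational). This is the source's "Suppose that `f_q(x) = 0`. Let `y = xq`. Then either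
`∑_{n ≤ y} χ_q(n) = h(q)` and `∑_{n ≤ y} n χ_q(n) = 0` or else
`y = ∑_{n ≤ [y]} n χ_q(n) / (∑_{n ≤ [y]} χ_q(n) - h(q))`" (p. 10), with `S_q(q/2)` in place of
`h(q)` (they are equal by Dirichlet's class-number formula, not used here). The printed
Proposition 1 ("then `x` is a rational number") keeps only the second alternative; see the module
docstring. [cite: Conrey2024CharacterSums, Prop. 1 and the display following it (p. 10)] -/
theorem Conrey2024.fq_eq_zero_dichotomy (h : Conrey2024_corollary1) {q : ℕ} (hsq : Squarefree q)
    (hq8 : q % 8 = 3) (hq3 : 3 < q) {x : ℝ} (hx : 0 < x) (h0 : Conrey2024.fq q x = 0) :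
    ((∑ n ∈ Finset.Icc 1 ⌊(q : ℝ) * x⌋₊, (jacobiSym (n : ℤ) q : ℝ)) = Conrey2024.S q (q / 2) ∧
        (∑ n ∈ Finset.Icc 1 ⌊(q : ℝ) * x⌋₊, (n : ℝ) * (jacobiSym (n : ℤ) q : ℝ)) = 0) ∨
      ((∑ n ∈ Finset.Icc 1 ⌊(q : ℝ) * x⌋₊, (jacobiSym (n : ℤ) q : ℝ)) ≠ Conrey2024.S q (q / 2) ∧
        x = (∑ n ∈ Finset.Icc 1 ⌊(q : ℝ) * x⌋₊, (n : ℝ) * (jacobiSym (n : ℤ) q : ℝ)) /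
          (q * ((∑ n ∈ Finset.Icc 1 ⌊(q : ℝ) * x⌋₊, (jacobiSym (n : ℤ) q : ℝ)) -
            Conrey2024.S q (q / 2)))) := by
  set A := ∑ n ∈ Finset.Icc 1 ⌊(q : ℝ) * x⌋₊, (jacobiSym (n : ℤ) q : ℝ) with hA
  set B := ∑ n ∈ Finset.Icc 1 ⌊(q : ℝ) * x⌋₊, (n : ℝ) * (jacobiSym (n : ℤ) q : ℝ) with hB
  set s := Conrey2024.S q (q / 2) with hs
  have hq0 : (0 : ℝ) < q := by exact_mod_cast (lt_trans (by norm_num) hq3 : 0 < q)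
  have hqx : (q : ℝ) * x ≠ 0 := (mul_pos hq0 hx).ne'
  have hc : 2 * π ^ 2 * x / Real.sqrt q ≠ 0 := by positivity
  -- Corollary 1 at `x`: `S_q(qx) = S_q(q/2)`
  have h1 : Conrey2024.S q (q * x) = s := by
    have := h q hsq hq8 hq3 x hx.le
    rw [h0, eq_comm, mul_eq_zero] at this
    rcases this with h' | h'
    · exact absurd h' hc
    · linarith
  -- `S_q(qx) = A - B/(qx)`
  rw [Conrey2024.S_eq_sum_sub_div, ← hA, ← hB] at h1
  by_cases hAs : A = s
  · left
    refine ⟨hAs, ?_⟩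
    have : B / (q * x) = 0 := by linarith
    rcases div_eq_zero_iff.mp this with h' | h'
    · exact h'
    · exact absurd h' hqx
  · right
    refine ⟨hAs, ?_⟩
    have hAs' : A - s ≠ 0 := sub_ne_zero.mpr hAs
    have h2 : B / (q * x) = A - s := by linarith
    field_simp at h2
    field_simp
    linarith [h2]

end Literature.NumberTheory.LFunctions

end
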